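import Summits.QuantumFields.QCD.Theses.NestedDissectionSea
import Literature.MathematicalPhysics.QuantumFieldTheory.QCDPhaseQuenched

/-!
# Stub `stub_censusDominates` of line `chirality-collapses-pseudospectrum`
(crux `Summit.QuantumFields.QCD.Theses.NestedDissectionSea.CoerciveSea`, item stmt-QuantumFields-13901)

The CHIRALITY SPLIT + MEASURE step: for any event `E` on `SU(3)` gauge fields that pointwise forces
a sheet-weighted pile-up family at level `2τ` with threshold `1/(2τ)` (orthonormal eigenvectors
`u_j` of `Γ_c · wilsonCell U μv 0 s`, `|ev_j| < 2τ`, `0 ≤ wgt_j`, `wgt_j |ev_j| ≤ 1`,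
`Σ_j wgt_j f(u_j) > 1/(2τ)`), the phase-quenched ratio obeys `P(E) ≤ P(A″) + P(B″)`, `A″`/`B″`
the same event with all members CHIRAL (`χ₀ ≤ ‖χ(u_j)‖`) resp. ACHIRAL (`‖χ(u_j)‖ < χ₀`) and
threshold `1/(4τ)`. (a) POINTWISE `E ⊆ A″ ∪ B″` (`CensusDominates.pointwise`):
`1/(2τ) = 1/(4τ) + 1/(4τ)` for every `τ` (junk-extended division), so the chiral or the achiral
partial sum exceeds `1/(4τ)` (`pigeonhole`); re-index the sub-family by `Fin (card)` (`restrict`).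
(b) MEASURABILITY (`measurableSet_chiral/achiral`): `A″`, `B″` are countable unions over `n` of
projections to the compact Hausdorff second-countable Borel configuration space of subsets of
`GaugeConfig × ((Fin n → box → ℂ) × (Fin n → ℝ) × (Fin n → ℝ))` cut out by finitely many CLOSED
conditions (orthonormality, eigen-relation via `continuous_wilsonDirac`, weight bounds, `χ₀ ≤ ‖χ‖`)
and finitely many STRICT inequalities of continuous functions; such sets are σ-compact
(`isSigmaCompact_inter_forall_lt`: `{f < g} = ⋃_k {f + 1/(k+1) ≤ g}`), so are their continuous
images, and σ-compact sets of a Hausdorff Borel space are measurable. (c) INTEGRALS (`ratio_le`):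
the weight `∏_f ‖det D_W(U, m_f)‖` is measurable, `≥ 0` and integrable against the probability
Wilson measure (`integrable_norm_det_diracMatrix`); `integral_mono` + `integral_add` if `1_E·wt`
is integrable (else its Bochner integral is `0`), then divide by the common normaliser `Z ≥ 0`.
No new definitions; helpers live in the sub-namespace `CensusDominates`.
-/

noncomputable section

open scoped BigOperators Classical
open MeasureTheory Filter Matrix
open Literature.MathematicalPhysics.QuantumLattice Literature.MathematicalPhysics.QuantumFieldTheory
  Literature.Probability.LatticeModels

namespace Summit.QuantumFields.QCD.Cruxes.CoerciveSea.ChiralityCollapsesPseudospectrum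

namespace CensusDominates

/-- Local notation: the colour group `SU(3)`. -/
local notation "𝔾" => Matrix.specialUnitaryGroup (Fin 3) ℂ

/-- Local notation: the parameter space `(U, u, ev, wgt)` of pile-up families of length `n`. -/
local notation "𝕏[" N ", " s ", " n "]" =>
  GaugeConfig 4 N 𝔾 × ((Fin n → {p // wilsonBox (0 : TorusSite 4 N) s p} → ℂ) × (Fin n → ℝ) × (Fin n → ℝ))

/-! ## General topology / measure theory -/

/-- The intersection of a σ-compact set with a closed set is σ-compact. -/
theorem isSigmaCompact_inter_isClosed {X : Type*} [TopologicalSpace X] {s t : Set X}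
    (hs : IsSigmaCompact s) (ht : IsClosed t) : IsSigmaCompact (s ∩ t) := by
  obtain ⟨K, hK, rfl⟩ := hs
  rw [Set.iUnion_inter]
  exact isSigmaCompact_iUnion_of_isCompact _ fun i => (hK i).inter_right ht

/-- The intersection of a σ-compact set with finitely many strict inequalities between continuous
real functions is σ-compact: `{∀ i, f i < g i} = ⋃_k {∀ i, f i + 1/(k+1) ≤ g i}` is a countable
union of closed sets. -/
theorem isSigmaCompact_inter_forall_lt {X ι : Type*} [TopologicalSpace X] [Finite ι] {s : Set X}
    (hs : IsSigmaCompact s) {f g : ι → X → ℝ} (hf : ∀ i, Continuous (f i))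
    (hg : ∀ i, Continuous (g i)) : IsSigmaCompact (s ∩ {x | ∀ i, f i x < g i x}) := by
  have hU : {x | ∀ i, f i x < g i x} = ⋃ k : ℕ, {x | ∀ i, f i x + 1 / ((k : ℝ) + 1) ≤ g i x} := by
    ext x
    simp only [Set.mem_setOf_eq, Set.mem_iUnion]
    constructor
    · intro hx
      have hev : ∀ᶠ k : ℕ in atTop, ∀ i, f i x + 1 / ((k : ℝ) + 1) ≤ g i x :=
        Filter.eventually_all.2 fun i =>
          ((tendsto_one_div_add_atTop_nhds_zero_nat (𝕜 := ℝ)).eventually_lt_const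
            (sub_pos.2 (hx i))).mono fun k hk => by linarith
      exact hev.exists
    · rintro ⟨k, hk⟩ i
      have hpos : (0 : ℝ) < 1 / ((k : ℝ) + 1) := Nat.one_div_pos_of_nat
      linarith [hk i]
  rw [hU, Set.inter_iUnion]
  refine isSigmaCompact_iUnion _ fun k => isSigmaCompact_inter_isClosed hs ?_
  simp only [Set.setOf_forall]
  exact isClosed_iInter fun i => isClosed_le ((hf i).add continuous_const) (hg i)

/-- The intersection of a σ-compact set with one strict inequality between continuous real
functions is σ-compact. -/
theorem isSigmaCompact_inter_lt {X : Type*} [TopologicalSpace X] {s : Set X}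
    (hs : IsSigmaCompact s) {f g : X → ℝ} (hf : Continuous f) (hg : Continuous g) :
    IsSigmaCompact (s ∩ {x | f x < g x}) := by
  simpa using isSigmaCompact_inter_forall_lt hs (f := fun _ : Unit => f) (g := fun _ : Unit => g)
    (fun _ => hf) (fun _ => hg)

/-- σ-compact subsets of a Hausdorff space whose open sets are measurable are measurable. -/
theorem measurableSet_of_isSigmaCompact {X : Type*} [TopologicalSpace X] [MeasurableSpace X]
    [OpensMeasurableSpace X] [T2Space X] {s : Set X} (hs : IsSigmaCompact s) :
    MeasurableSet s := by
  obtain ⟨K, hK, rfl⟩ := hs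
  exact MeasurableSet.iUnion fun i => (hK i).measurableSet

/-- Membership in the first projection of a subset of a product. -/
theorem mem_image_fst {α β : Type*} {S : Set (α × β)} {a : α} :
    a ∈ Prod.fst '' S ↔ ∃ b, (a, b) ∈ S :=
  ⟨fun ⟨x, hx, hxa⟩ => ⟨x.2, by subst hxa; exact hx⟩, fun ⟨b, h⟩ => ⟨(a, b), h, rfl⟩⟩

/-! ## (a) The chirality split -/

/-- Pigeonhole on two partial sums: if `c + c < Σ_j w_j` then, for any predicate `P`, either the
`P`-indices or the `¬P`-indices carry a partial sum `> c`. -/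
theorem pigeonhole {ι : Type*} [Fintype ι] (w : ι → ℝ) (P : ι → Prop) (c : ℝ)
    (h : c + c < ∑ j, w j) :
    (∃ S : Finset ι, (∀ k ∈ S, P k) ∧ c < ∑ j ∈ S, w j) ∨
      (∃ S : Finset ι, (∀ k ∈ S, ¬ P k) ∧ c < ∑ j ∈ S, w j) := by
  by_cases h1 : c < ∑ j ∈ Finset.univ.filter P, w j
  · exact Or.inl ⟨_, fun k hk => (Finset.mem_filter.1 hk).2, h1⟩
  · refine Or.inr ⟨Finset.univ.filter fun j => ¬ P j, fun k hk => (Finset.mem_filter.1 hk).2, ?_⟩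
    have := Finset.sum_filter_add_sum_filter_not Finset.univ P w
    linarith [not_lt.1 h1]

/-- Restriction of an orthonormal family with per-member data `(ev, wgt)` to a sub-finset of its
indices, re-indexed by `Fin (card)`: orthonormality, any per-member property `Q` and any property
`R` valid on the sub-finset restrict, and the sum of any per-member quantity `F` over the new
family is the old partial sum. -/
theorem restrict {n : ℕ} {V : Type*} (u : Fin n → V) (ev wgt : Fin n → ℝ) (ip : V → V → ℂ)
    (Q : V → ℝ → ℝ → Prop) (F : V → ℝ → ℝ → ℝ) (R : V → Prop) (S : Finset (Fin n))
    (ho : ∀ i j, ip (u i) (u j) = if i = j then 1 else 0) (hQ : ∀ j, Q (u j) (ev j) (wgt j))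
    (hR : ∀ k ∈ S, R (u k)) :
    ∃ m : ℕ, ∃ u' : Fin m → V, ∃ ev' wgt' : Fin m → ℝ,
      (∀ i j, ip (u' i) (u' j) = if i = j then 1 else 0) ∧ (∀ j, Q (u' j) (ev' j) (wgt' j)) ∧
        (∀ j, R (u' j)) ∧ ∑ j, F (u' j) (ev' j) (wgt' j) = ∑ k ∈ S, F (u k) (ev k) (wgt k) := by
  set e : Fin S.card ≃ {k // k ∈ S} := S.equivFin.symm with he
  refine ⟨S.card, fun i => u (e i), fun i => ev (e i), fun i => wgt (e i), fun i j => ?_,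
    fun j => hQ _, fun j => hR _ (e j).2, ?_⟩
  · rw [ho]
    exact if_congr (Subtype.val_inj.trans e.apply_eq_iff_eq) rfl rfl
  · rw [← Finset.sum_coe_sort S]
    exact e.sum_comp (fun k : {k // k ∈ S} => F (u k) (ev k) (wgt k))

variable {N : ℕ} [NeZero N]

/-- **(a) `E ⊆ A″ ∪ B″` pointwise.** A pile-up family at level `2τ` with threshold `1/(2τ)` contains
a chiral (`χ₀ ≤ ‖χ(u_j)‖` for all members) or an achiral (`‖χ(u_j)‖ < χ₀`) sub-family with
threshold `1/(4τ)`. -/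
theorem pointwise (s : Fin 4 → ℕ) (μv τ χ₀ : ℝ) (U : GaugeConfig 4 N 𝔾)
    (h : ∃ n : ℕ, ∃ u : Fin n → ({p // wilsonBox (0 : TorusSite 4 N) s p} → ℂ), ∃ ev wgt : Fin n → ℝ, (∀ i j, ∑ p, star (u i p) * u j p = if i = j then 1 else 0) ∧ (∀ j, (wilsonCell U μv 0 s).mulVec (u j) = fun p => (ev j : ℂ) * gammaFive p.1.2.2 p.1.2.2 * u j p) ∧ (∀ j, |ev j| < 2 * τ ∧ 0 ≤ wgt j ∧ wgt j * |ev j| ≤ 1) ∧ 1 / (2 * τ) < ∑ j, wgt j * ∑ p, if childrenInterior s p then (0 : ℝ) else ‖u j p‖ ^ 2) :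
    (∃ n : ℕ, ∃ u : Fin n → ({p // wilsonBox (0 : TorusSite 4 N) s p} → ℂ), ∃ ev wgt : Fin n → ℝ, (∀ i j, ∑ p, star (u i p) * u j p = if i = j then 1 else 0) ∧ (∀ j, (wilsonCell U μv 0 s).mulVec (u j) = fun p => (ev j : ℂ) * gammaFive p.1.2.2 p.1.2.2 * u j p) ∧ (∀ j, |ev j| < 2 * τ ∧ 0 ≤ wgt j ∧ wgt j * |ev j| ≤ 1) ∧ (∀ j, χ₀ ≤ ‖∑ p, star (u j p) * gammaFive p.1.2.2 p.1.2.2 * u j p‖) ∧ 1 / (4 * τ) < ∑ j, wgt j * ∑ p, if childrenInterior s p then (0 : ℝ) else ‖u j p‖ ^ 2) ∨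
      (∃ n : ℕ, ∃ u : Fin n → ({p // wilsonBox (0 : TorusSite 4 N) s p} → ℂ), ∃ ev wgt : Fin n → ℝ, (∀ i j, ∑ p, star (u i p) * u j p = if i = j then 1 else 0) ∧ (∀ j, (wilsonCell U μv 0 s).mulVec (u j) = fun p => (ev j : ℂ) * gammaFive p.1.2.2 p.1.2.2 * u j p) ∧ (∀ j, |ev j| < 2 * τ ∧ 0 ≤ wgt j ∧ wgt j * |ev j| ≤ 1) ∧ (∀ j, ‖∑ p, star (u j p) * gammaFive p.1.2.2 p.1.2.2 * u j p‖ < χ₀) ∧ 1 / (4 * τ) < ∑ j, wgt j * ∑ p, if childrenInterior s p then (0 : ℝ) else ‖u j p‖ ^ 2) := by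
  obtain ⟨n, u, ev, wgt, ho, he, hb, hp⟩ := h
  rw [show (1 : ℝ) / (2 * τ) = 1 / (4 * τ) + 1 / (4 * τ) by ring] at hp
  rcases pigeonhole (fun j => wgt j * ∑ p, if childrenInterior s p then (0 : ℝ) else ‖u j p‖ ^ 2)
      (fun j => χ₀ ≤ ‖∑ p, star (u j p) * gammaFive p.1.2.2 p.1.2.2 * u j p‖) (1 / (4 * τ)) hp with
    ⟨S, hS, hlt⟩ | ⟨S, hS, hlt⟩
  all_goals
    have key := fun (R : ({p // wilsonBox (0 : TorusSite 4 N) s p} → ℂ) → Prop)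
      (hR : ∀ k ∈ S, R (u k)) => restrict u ev wgt (fun v v' => ∑ p, star (v p) * v' p)
      (fun v e w => (wilsonCell U μv 0 s).mulVec v =
          (fun p => (e : ℂ) * gammaFive p.1.2.2 p.1.2.2 * v p) ∧ (|e| < 2 * τ ∧ 0 ≤ w ∧ w * |e| ≤ 1))
      (fun v e w => w * ∑ p, if childrenInterior s p then (0 : ℝ) else ‖v p‖ ^ 2) R S ho
      (fun j => ⟨he j, hb j⟩) hR
  · left
    obtain ⟨m, u', ev', wgt', ho', hQ', hR', hsum⟩ :=
      key (fun v => χ₀ ≤ ‖∑ p, star (v p) * gammaFive p.1.2.2 p.1.2.2 * v p‖) hS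
    exact ⟨m, u', ev', wgt', ho', fun j => (hQ' j).1, fun j => (hQ' j).2, hR', hlt.trans_eq hsum.symm⟩
  · right
    obtain ⟨m, u', ev', wgt', ho', hQ', hR', hsum⟩ :=
      key (fun v => ‖∑ p, star (v p) * gammaFive p.1.2.2 p.1.2.2 * v p‖ < χ₀)
        (fun k hk => not_le.1 (hS k hk))
    exact ⟨m, u', ev', wgt', ho', fun j => (hQ' j).1, fun j => (hQ' j).2, hR', hlt.trans_eq hsum.symm⟩

/-! ## (b) Measurability of the chiral / achiral pile-up events -/

omit [NeZero N] in
/-- The Dirichlet cell matrix depends continuously on the gauge field (a principal submatrix of the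
continuous `U ↦ D_W(U, μ, 1)`, `continuous_wilsonDirac`). -/
theorem continuous_wilsonCell (μ : ℝ) (x : TorusSite 4 N) (s : Fin 4 → ℕ) :
    Continuous fun U : GaugeConfig 4 N 𝔾 => wilsonCell U μ x s := by
  refine continuous_pi fun i => continuous_pi fun j => ?_
  simp only [wilsonCell, Matrix.toSquareBlockProp_def, Matrix.of_apply]
  exact (continuous_wilsonDirac (fundamentalRep (Fin 3)) (continuous_fundamentalRep (Fin 3)) μ 1).matrix_elem
    _ _

/-- The CLOSED conditions of a pile-up family (orthonormality, eigen-relation, weight bounds) cut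
out a closed subset of the parameter space. -/
theorem isClosed_core (s : Fin 4 → ℕ) (n : ℕ) (μv : ℝ) :
    IsClosed {x : 𝕏[N, s, n] | (∀ i j, ∑ p, star (x.2.1 i p) * x.2.1 j p = if i = j then 1 else 0) ∧
      (∀ j, (wilsonCell x.1 μv 0 s).mulVec (x.2.1 j) = fun p => (x.2.2.1 j : ℂ) * gammaFive p.1.2.2 p.1.2.2 * x.2.1 j p) ∧
      (∀ j, 0 ≤ x.2.2.2 j ∧ x.2.2.2 j * |x.2.2.1 j| ≤ 1)} := by
  have hu : ∀ (j : Fin n) (p : {p // wilsonBox (0 : TorusSite 4 N) s p}),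
      Continuous fun x : 𝕏[N, s, n] => x.2.1 j p := fun j p => by fun_prop
  have hev : ∀ j : Fin n, Continuous fun x : 𝕏[N, s, n] => x.2.2.1 j := fun j => by fun_prop
  have hwgt : ∀ j : Fin n, Continuous fun x : 𝕏[N, s, n] => x.2.2.2 j := fun j => by fun_prop
  simp only [Set.setOf_and, Set.setOf_forall]
  refine (isClosed_iInter fun i => isClosed_iInter fun j => isClosed_eq ?_ continuous_const).inter
    ((isClosed_iInter fun j => isClosed_eq ?_ ?_).inter
      (isClosed_iInter fun j => (isClosed_le continuous_const (hwgt j)).inter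
        (isClosed_le ((hwgt j).mul (hev j).abs) continuous_const)))
  · exact continuous_finsetSum _ fun p _ => (hu i p).star.mul (hu j p)
  · exact ((continuous_wilsonCell μv 0 s).comp continuous_fst).matrix_mulVec
      (continuous_pi fun p => hu j p)
  · exact continuous_pi fun p =>
      ((Complex.continuous_ofReal.comp (hev j)).mul continuous_const).mul (hu j p)

/-- The chirality `‖χ(u_j)‖ = ‖Σ_p conj(u_j p) (γ₅)_{αα} u_j p‖` of the `j`-th member is a
continuous function on the parameter space. -/
theorem continuous_chi (s : Fin 4 → ℕ) (n : ℕ) (j : Fin n) :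
    Continuous fun x : 𝕏[N, s, n] =>
      ‖∑ p, star (x.2.1 j p) * gammaFive p.1.2.2 p.1.2.2 * x.2.1 j p‖ := by
  have hu : ∀ p : {p // wilsonBox (0 : TorusSite 4 N) s p},
      Continuous fun x : 𝕏[N, s, n] => x.2.1 j p := fun p => by fun_prop
  exact (continuous_finsetSum _ fun p _ => ((hu p).star.mul continuous_const).mul (hu p)).norm

/-- The sheet-weighted pile-up `Σ_j wgt_j f(u_j)` is a continuous function on the parameter
space. -/
theorem continuous_pile (s : Fin 4 → ℕ) (n : ℕ) :
    Continuous fun x : 𝕏[N, s, n] =>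
      ∑ j, x.2.2.2 j * ∑ p, if childrenInterior s p then (0 : ℝ) else ‖x.2.1 j p‖ ^ 2 := by
  have hu : ∀ (j : Fin n) (p : {p // wilsonBox (0 : TorusSite 4 N) s p}),
      Continuous fun x : 𝕏[N, s, n] => x.2.1 j p := fun j p => by fun_prop
  have hwgt : ∀ j : Fin n, Continuous fun x : 𝕏[N, s, n] => x.2.2.2 j := fun j => by fun_prop
  refine continuous_finsetSum _ fun j _ => (hwgt j).mul (continuous_finsetSum _ fun p _ => ?_)
  exact Continuous.if_const _ continuous_const ((hu j p).norm.pow 2)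

/-- The CHIRAL pile-up families of length `n` form a σ-compact subset of the parameter space. -/
theorem isSigmaCompact_chiral (s : Fin 4 → ℕ) (n : ℕ) (μv τ χ₀ : ℝ) :
    IsSigmaCompact {x : 𝕏[N, s, n] | (∀ i j, ∑ p, star (x.2.1 i p) * x.2.1 j p = if i = j then 1 else 0) ∧
      (∀ j, (wilsonCell x.1 μv 0 s).mulVec (x.2.1 j) = fun p => (x.2.2.1 j : ℂ) * gammaFive p.1.2.2 p.1.2.2 * x.2.1 j p) ∧
      (∀ j, |x.2.2.1 j| < 2 * τ ∧ 0 ≤ x.2.2.2 j ∧ x.2.2.2 j * |x.2.2.1 j| ≤ 1) ∧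
      (∀ j, χ₀ ≤ ‖∑ p, star (x.2.1 j p) * gammaFive p.1.2.2 p.1.2.2 * x.2.1 j p‖) ∧
      1 / (4 * τ) < ∑ j, x.2.2.2 j * ∑ p, if childrenInterior s p then (0 : ℝ) else ‖x.2.1 j p‖ ^ 2} := by
  have hev : ∀ j : Fin n, Continuous fun x : 𝕏[N, s, n] => x.2.2.1 j := fun j => by fun_prop
  have h : {x : 𝕏[N, s, n] | (∀ i j, ∑ p, star (x.2.1 i p) * x.2.1 j p = if i = j then 1 else 0) ∧
      (∀ j, (wilsonCell x.1 μv 0 s).mulVec (x.2.1 j) = fun p => (x.2.2.1 j : ℂ) * gammaFive p.1.2.2 p.1.2.2 * x.2.1 j p) ∧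
      (∀ j, |x.2.2.1 j| < 2 * τ ∧ 0 ≤ x.2.2.2 j ∧ x.2.2.2 j * |x.2.2.1 j| ≤ 1) ∧
      (∀ j, χ₀ ≤ ‖∑ p, star (x.2.1 j p) * gammaFive p.1.2.2 p.1.2.2 * x.2.1 j p‖) ∧
      1 / (4 * τ) < ∑ j, x.2.2.2 j * ∑ p, if childrenInterior s p then (0 : ℝ) else ‖x.2.1 j p‖ ^ 2} =
      (({x : 𝕏[N, s, n] | (∀ i j, ∑ p, star (x.2.1 i p) * x.2.1 j p = if i = j then 1 else 0) ∧
        (∀ j, (wilsonCell x.1 μv 0 s).mulVec (x.2.1 j) = fun p => (x.2.2.1 j : ℂ) * gammaFive p.1.2.2 p.1.2.2 * x.2.1 j p) ∧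
        (∀ j, 0 ≤ x.2.2.2 j ∧ x.2.2.2 j * |x.2.2.1 j| ≤ 1)} ∩
        {x | ∀ j, χ₀ ≤ ‖∑ p, star (x.2.1 j p) * gammaFive p.1.2.2 p.1.2.2 * x.2.1 j p‖}) ∩
        {x | ∀ j, |x.2.2.1 j| < 2 * τ}) ∩
      {x | 1 / (4 * τ) < ∑ j, x.2.2.2 j * ∑ p, if childrenInterior s p then (0 : ℝ) else ‖x.2.1 j p‖ ^ 2} := by
    ext x
    simp only [Set.mem_inter_iff, Set.mem_setOf_eq]
    constructor
    · rintro ⟨ho, he, hb, hc, hp⟩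
      exact ⟨⟨⟨⟨ho, he, fun j => (hb j).2⟩, hc⟩, fun j => (hb j).1⟩, hp⟩
    · rintro ⟨⟨⟨⟨ho, he, hb⟩, hc⟩, hlt⟩, hp⟩
      exact ⟨ho, he, fun j => ⟨hlt j, hb j⟩, hc, hp⟩
  rw [h]
  refine isSigmaCompact_inter_lt (isSigmaCompact_inter_forall_lt
    ((isSigmaCompact_univ.of_isClosed_subset ((isClosed_core s n μv).inter ?_) (Set.subset_univ _)))
    (fun j => (hev j).abs) (fun _ => continuous_const)) continuous_const (continuous_pile s n)
  simp only [Set.setOf_forall]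
  exact isClosed_iInter fun j => isClosed_le continuous_const (continuous_chi s n j)

/-- The ACHIRAL pile-up families of length `n` form a σ-compact subset of the parameter space. -/
theorem isSigmaCompact_achiral (s : Fin 4 → ℕ) (n : ℕ) (μv τ χ₀ : ℝ) :
    IsSigmaCompact {x : 𝕏[N, s, n] | (∀ i j, ∑ p, star (x.2.1 i p) * x.2.1 j p = if i = j then 1 else 0) ∧
      (∀ j, (wilsonCell x.1 μv 0 s).mulVec (x.2.1 j) = fun p => (x.2.2.1 j : ℂ) * gammaFive p.1.2.2 p.1.2.2 * x.2.1 j p) ∧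
      (∀ j, |x.2.2.1 j| < 2 * τ ∧ 0 ≤ x.2.2.2 j ∧ x.2.2.2 j * |x.2.2.1 j| ≤ 1) ∧
      (∀ j, ‖∑ p, star (x.2.1 j p) * gammaFive p.1.2.2 p.1.2.2 * x.2.1 j p‖ < χ₀) ∧
      1 / (4 * τ) < ∑ j, x.2.2.2 j * ∑ p, if childrenInterior s p then (0 : ℝ) else ‖x.2.1 j p‖ ^ 2} := by
  have hev : ∀ j : Fin n, Continuous fun x : 𝕏[N, s, n] => x.2.2.1 j := fun j => by fun_prop
  have h : {x : 𝕏[N, s, n] | (∀ i j, ∑ p, star (x.2.1 i p) * x.2.1 j p = if i = j then 1 else 0) ∧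
      (∀ j, (wilsonCell x.1 μv 0 s).mulVec (x.2.1 j) = fun p => (x.2.2.1 j : ℂ) * gammaFive p.1.2.2 p.1.2.2 * x.2.1 j p) ∧
      (∀ j, |x.2.2.1 j| < 2 * τ ∧ 0 ≤ x.2.2.2 j ∧ x.2.2.2 j * |x.2.2.1 j| ≤ 1) ∧
      (∀ j, ‖∑ p, star (x.2.1 j p) * gammaFive p.1.2.2 p.1.2.2 * x.2.1 j p‖ < χ₀) ∧
      1 / (4 * τ) < ∑ j, x.2.2.2 j * ∑ p, if childrenInterior s p then (0 : ℝ) else ‖x.2.1 j p‖ ^ 2} =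
      (({x : 𝕏[N, s, n] | (∀ i j, ∑ p, star (x.2.1 i p) * x.2.1 j p = if i = j then 1 else 0) ∧
        (∀ j, (wilsonCell x.1 μv 0 s).mulVec (x.2.1 j) = fun p => (x.2.2.1 j : ℂ) * gammaFive p.1.2.2 p.1.2.2 * x.2.1 j p) ∧
        (∀ j, 0 ≤ x.2.2.2 j ∧ x.2.2.2 j * |x.2.2.1 j| ≤ 1)} ∩
        {x | ∀ j, |x.2.2.1 j| < 2 * τ}) ∩
        {x | ∀ j, ‖∑ p, star (x.2.1 j p) * gammaFive p.1.2.2 p.1.2.2 * x.2.1 j p‖ < χ₀}) ∩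
      {x | 1 / (4 * τ) < ∑ j, x.2.2.2 j * ∑ p, if childrenInterior s p then (0 : ℝ) else ‖x.2.1 j p‖ ^ 2} := by
    ext x
    simp only [Set.mem_inter_iff, Set.mem_setOf_eq]
    constructor
    · rintro ⟨ho, he, hb, hc, hp⟩
      exact ⟨⟨⟨⟨ho, he, fun j => (hb j).2⟩, fun j => (hb j).1⟩, hc⟩, hp⟩
    · rintro ⟨⟨⟨⟨ho, he, hb⟩, hlt⟩, hc⟩, hp⟩
      exact ⟨ho, he, fun j => ⟨hlt j, hb j⟩, hc, hp⟩
  rw [h]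
  exact isSigmaCompact_inter_lt (isSigmaCompact_inter_forall_lt (isSigmaCompact_inter_forall_lt
    ((isSigmaCompact_univ.of_isClosed_subset (isClosed_core s n μv) (Set.subset_univ _)))
    (fun j => (hev j).abs) (fun _ => continuous_const)) (fun j => continuous_chi s n j)
    (fun _ => continuous_const)) continuous_const (continuous_pile s n)

/-- **(b) The chiral pile-up event `A″` is measurable** (a countable union of continuous images of
σ-compact sets in the compact Hausdorff Borel space of gauge fields). -/
theorem measurableSet_chiral (s : Fin 4 → ℕ) (μv τ χ₀ : ℝ) :
    MeasurableSet {U : GaugeConfig 4 N 𝔾 | ∃ n : ℕ, ∃ u : Fin n → ({p // wilsonBox (0 : TorusSite 4 N) s p} → ℂ), ∃ ev wgt : Fin n → ℝ, (∀ i j, ∑ p, star (u i p) * u j p = if i = j then 1 else 0) ∧ (∀ j, (wilsonCell U μv 0 s).mulVec (u j) = fun p => (ev j : ℂ) * gammaFive p.1.2.2 p.1.2.2 * u j p) ∧ (∀ j, |ev j| < 2 * τ ∧ 0 ≤ wgt j ∧ wgt j * |ev j| ≤ 1) ∧ (∀ j, χ₀ ≤ ‖∑ p, star (u j p) * gammaFive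 p.1.2.2 p.1.2.2 * u j p‖) ∧ 1 / (4 * τ) < ∑ j, wgt j * ∑ p, if childrenInterior s p then (0 : ℝ) else ‖u j p‖ ^ 2} := by
  have h : {U : GaugeConfig 4 N 𝔾 | ∃ n : ℕ, ∃ u : Fin n → ({p // wilsonBox (0 : TorusSite 4 N) s p} → ℂ), ∃ ev wgt : Fin n → ℝ, (∀ i j, ∑ p, star (u i p) * u j p = if i = j then 1 else 0) ∧ (∀ j, (wilsonCell U μv 0 s).mulVec (u j) = fun p => (ev j : ℂ) * gammaFive p.1.2.2 p.1.2.2 * u j p) ∧ (∀ j, |ev j| < 2 * τ ∧ 0 ≤ wgt j ∧ wgt j * |ev j| ≤ 1) ∧ (∀ j, χ₀ ≤ ‖∑ p, star (u j p) * gammaFive p.1.2.2 p.1.2.2 * u j p‖) ∧ 1 / (4 * τ) < ∑ j, wgt j * ∑ p, if childrenInterior s p then (0 : ℝ) else ‖u j p‖ ^ 2} =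
      ⋃ n : ℕ, Prod.fst '' {x : 𝕏[N, s, n] | (∀ i j, ∑ p, star (x.2.1 i p) * x.2.1 j p = if i = j then 1 else 0) ∧
        (∀ j, (wilsonCell x.1 μv 0 s).mulVec (x.2.1 j) = fun p => (x.2.2.1 j : ℂ) * gammaFive p.1.2.2 p.1.2.2 * x.2.1 j p) ∧
        (∀ j, |x.2.2.1 j| < 2 * τ ∧ 0 ≤ x.2.2.2 j ∧ x.2.2.2 j * |x.2.2.1 j| ≤ 1) ∧
        (∀ j, χ₀ ≤ ‖∑ p, star (x.2.1 j p) * gammaFive p.1.2.2 p.1.2.2 * x.2.1 j p‖) ∧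
        1 / (4 * τ) < ∑ j, x.2.2.2 j * ∑ p, if childrenInterior s p then (0 : ℝ) else ‖x.2.1 j p‖ ^ 2} := by
    ext U
    simp only [Set.mem_setOf_eq, Set.mem_iUnion, mem_image_fst, Prod.exists]
  rw [h]
  exact MeasurableSet.iUnion fun n =>
    measurableSet_of_isSigmaCompact ((isSigmaCompact_chiral s n μv τ χ₀).image continuous_fst)

/-- **(b) The achiral pile-up event `B″` is measurable.** -/
theorem measurableSet_achiral (s : Fin 4 → ℕ) (μv τ χ₀ : ℝ) :
    MeasurableSet {U : GaugeConfig 4 N 𝔾 | ∃ n : ℕ, ∃ u : Fin n → ({p // wilsonBox (0 : TorusSite 4 N) s p} → ℂ), ∃ ev wgt : Fin n → ℝ, (∀ i j, ∑ p, star (u i p) * u j p = if i = j then 1 else 0) ∧ (∀ j, (wilsonCell U μv 0 s).mulVec (u j) = fun p => (ev j : ℂ) * gammaFive p.1.2.2 p.1.2.2 * u j p) ∧ (∀ j, |ev j| < 2 * τ ∧ 0 ≤ wgt j ∧ wgt j * |ev j| ≤ 1) ∧ (∀ j, ‖∑ p, star (u j p) * gammaFive p.1.2.2 p.1.2.2 *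 u j p‖ < χ₀) ∧ 1 / (4 * τ) < ∑ j, wgt j * ∑ p, if childrenInterior s p then (0 : ℝ) else ‖u j p‖ ^ 2} := by
  have h : {U : GaugeConfig 4 N 𝔾 | ∃ n : ℕ, ∃ u : Fin n → ({p // wilsonBox (0 : TorusSite 4 N) s p} → ℂ), ∃ ev wgt : Fin n → ℝ, (∀ i j, ∑ p, star (u i p) * u j p = if i = j then 1 else 0) ∧ (∀ j, (wilsonCell U μv 0 s).mulVec (u j) = fun p => (ev j : ℂ) * gammaFive p.1.2.2 p.1.2.2 * u j p) ∧ (∀ j, |ev j| < 2 * τ ∧ 0 ≤ wgt j ∧ wgt j * |ev j| ≤ 1) ∧ (∀ j, ‖∑ p, star (u j p) * gammaFive p.1.2.2 p.1.2.2 * u j p‖ < χ₀) ∧ 1 / (4 * τ) < ∑ j, wgt j * ∑ p, if childrenInterior s p then (0 : ℝ) else ‖u j p‖ ^ 2} =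
      ⋃ n : ℕ, Prod.fst '' {x : 𝕏[N, s, n] | (∀ i j, ∑ p, star (x.2.1 i p) * x.2.1 j p = if i = j then 1 else 0) ∧
        (∀ j, (wilsonCell x.1 μv 0 s).mulVec (x.2.1 j) = fun p => (x.2.2.1 j : ℂ) * gammaFive p.1.2.2 p.1.2.2 * x.2.1 j p) ∧
        (∀ j, |x.2.2.1 j| < 2 * τ ∧ 0 ≤ x.2.2.2 j ∧ x.2.2.2 j * |x.2.2.1 j| ≤ 1) ∧
        (∀ j, ‖∑ p, star (x.2.1 j p) * gammaFive p.1.2.2 p.1.2.2 * x.2.1 j p‖ < χ₀) ∧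
        1 / (4 * τ) < ∑ j, x.2.2.2 j * ∑ p, if childrenInterior s p then (0 : ℝ) else ‖x.2.1 j p‖ ^ 2} := by
    ext U
    simp only [Set.mem_setOf_eq, Set.mem_iUnion, mem_image_fst, Prod.exists]
  rw [h]
  exact MeasurableSet.iUnion fun n =>
    measurableSet_of_isSigmaCompact ((isSigmaCompact_achiral s n μv τ χ₀).image continuous_fst)

/-! ## (c) Monotone subadditivity of the phase-quenched ratio -/

/-- **(c) Ratio subadditivity.** For a non-negative measurable integrable weight `wt`, measurable
events `A`, `B` and any event `E ⊆ A ∪ B`, the `wt`-weighted ratios satisfy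
`P(E) ≤ P(A) + P(B)` — with the Bochner conventions (`P(E)` is junk `0` if `1_E · wt` is not
integrable; `x / 0 = 0`). -/
theorem ratio_le {Ω : Type*} [MeasurableSpace Ω] (μ : Measure Ω) (wt : Ω → ℝ)
    (hwt0 : ∀ U, 0 ≤ wt U) (hwtm : Measurable wt) (hwti : Integrable wt μ) (E A B : Ω → Prop)
    (hA : MeasurableSet {U | A U}) (hB : MeasurableSet {U | B U}) (hEAB : ∀ U, E U → A U ∨ B U) :
    (∫ U, (if E U then (1 : ℝ) else 0) * wt U ∂μ) / (∫ U, wt U ∂μ) ≤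
      (∫ U, (if A U then (1 : ℝ) else 0) * wt U ∂μ) / (∫ U, wt U ∂μ) +
        (∫ U, (if B U then (1 : ℝ) else 0) * wt U ∂μ) / (∫ U, wt U ∂μ) := by
  have hind0 : ∀ (P : Prop) [Decidable P] (U : Ω), 0 ≤ (if P then (1 : ℝ) else 0) * wt U :=
    fun P _ U => mul_nonneg (by split_ifs <;> norm_num) (hwt0 U)
  have hint : ∀ {P : Ω → Prop}, MeasurableSet {U | P U} →
      Integrable (fun U => (if P U then (1 : ℝ) else 0) * wt U) μ := by
    intro P hP
    refine hwti.mono' ((Measurable.ite hP measurable_const measurable_const).mul hwtm).aestronglyMeasurable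
      (Eventually.of_forall fun U => ?_)
    rw [Real.norm_eq_abs, abs_mul, abs_of_nonneg (hwt0 U)]
    split_ifs
    · rw [abs_one, one_mul]
    · rw [abs_zero, zero_mul]
      exact hwt0 U
  rw [← add_div]
  refine div_le_div_of_nonneg_right ?_ (integral_nonneg hwt0)
  have hsum : 0 ≤ (∫ U, (if A U then (1 : ℝ) else 0) * wt U ∂μ) +
      ∫ U, (if B U then (1 : ℝ) else 0) * wt U ∂μ :=
    add_nonneg (integral_nonneg fun U => hind0 _ U) (integral_nonneg fun U => hind0 _ U)
  by_cases hEi : Integrable (fun U => (if E U then (1 : ℝ) else 0) * wt U) μ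
  · rw [← integral_add (hint hA) (hint hB)]
    refine integral_mono hEi ((hint hA).add (hint hB)) fun U => ?_
    dsimp only
    by_cases hEU : E U
    · rw [if_pos hEU, one_mul]
      rcases hEAB U hEU with hAU | hBU
      · rw [if_pos hAU, one_mul]
        linarith [hind0 (B U) U]
      · rw [if_pos hBU, one_mul]
        linarith [hind0 (A U) U]
    · rw [if_neg hEU, zero_mul]
      exact add_nonneg (hind0 _ U) (hind0 _ U)
  · rw [integral_undef hEi]
    exact hsum

end CensusDominates

/-- **Stub 2 — `censusDominates` (CHIRALITY SPLIT + MEASURE STEP).** Any event `E` on gauge fields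
that pointwise forces a pile-up family at `μv` (orthonormal eigenvectors of
`Γ_c · wilsonCell U μv 0 s`, `|ev_j| < 2τ`, `0 ≤ wgt_j`, `wgt_j |ev_j| ≤ 1`,
`Σ wgt_j f(u_j) > 1/(2τ)`) has phase-quenched ratio `P(E) ≤ P(A″) + P(B″)`, `A″`/`B″` = such a
family with all members CHIRAL (`χ₀ ≤ ‖χ(u_j)‖`) / ACHIRAL (`‖χ(u_j)‖ < χ₀`) piling `> 1/(4τ)`,
`P` verbatim the crux's ratio of Bochner integrals against `wilsonMeasure (fundamentalRep (Fin 3)) β`.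
Proof: `CensusDominates.pointwise` (split), `measurableSet_chiral/achiral` (σ-compact
projections), `ratio_le` (integrability of the bounded weight, monotone subadditivity). -/
theorem stub_censusDominates :
    ∀ (N : ℕ) [NeZero N] (β : ℝ) (Nf : ℕ) (mq : Fin Nf → ℝ) (s : Fin 4 → ℕ) (μv τ χ₀ : ℝ)
      (E : GaugeConfig 4 N (Matrix.specialUnitaryGroup (Fin 3) ℂ) → Prop),
      (∀ U, E U → ∃ n : ℕ, ∃ u : Fin n → ({p // wilsonBox (0 : TorusSite 4 N) s p} → ℂ), ∃ ev wgt : Fin n → ℝ, (∀ i j, ∑ p, star (u i p) * u j p = if i = j then 1 else 0) ∧ (∀ j, (wilsonCell U μv 0 s).mulVec (u j) = fun p => (ev j : ℂ) * gammaFive p.1.2.2 p.1.2.2 * u j p) ∧ (∀ j, |ev j| < 2 * τ ∧ 0 ≤ wgt j ∧ wgt j * |ev j| ≤ 1) ∧ 1 / (2 * τ) < ∑ j, wgt j * ∑ p, if childrenInterior s p then (0 : ℝ) else ‖u j p‖ ^ 2) →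
      (∫ U : GaugeConfig 4 N (Matrix.specialUnitaryGroup (Fin 3) ℂ), (if (E U) then (1 : ℝ) else 0) * ∏ f, ‖fermionDet (wilsonDirac (fundamentalRep (Fin 3)) U (mq f) 1)‖ ∂(wilsonMeasure (fundamentalRep (Fin 3)) β)) /
        (∫ U : GaugeConfig 4 N (Matrix.specialUnitaryGroup (Fin 3) ℂ), ∏ f, ‖fermionDet (wilsonDirac (fundamentalRep (Fin 3)) U (mq f) 1)‖ ∂(wilsonMeasure (fundamentalRep (Fin 3)) β)) ≤
      (∫ U : GaugeConfig 4 N (Matrix.specialUnitaryGroup (Fin 3) ℂ), (if (∃ n : ℕ, ∃ u : Fin n → ({p // wilsonBox (0 : TorusSite 4 N) s p} → ℂ), ∃ ev wgt : Fin n → ℝ, (∀ i j, ∑ p, star (u i p) * u j p = if i = j then 1 else 0) ∧ (∀ j, (wilsonCell U μv 0 s).mulVec (u j) = fun p => (ev j : ℂ) * gammaFive p.1.2.2 p.1.2.2 * u j p) ∧ (∀ j, |ev j| < 2 * τ ∧ 0 ≤ wgt j ∧ wgt j * |ev j| ≤ 1) ∧ (∀ j, χ₀ ≤ ‖∑ p,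 star (u j p) * gammaFive p.1.2.2 p.1.2.2 * u j p‖) ∧ 1 / (4 * τ) < ∑ j, wgt j * ∑ p, if childrenInterior s p then (0 : ℝ) else ‖u j p‖ ^ 2) then (1 : ℝ) else 0) * ∏ f, ‖fermionDet (wilsonDirac (fundamentalRep (Fin 3)) U (mq f) 1)‖ ∂(wilsonMeasure (fundamentalRep (Fin 3)) β)) /
        (∫ U : GaugeConfig 4 N (Matrix.specialUnitaryGroup (Fin 3) ℂ), ∏ f, ‖fermionDet (wilsonDirac (fundamentalRep (Fin 3)) U (mq f) 1)‖ ∂(wilsonMeasure (fundamentalRep (Fin 3)) β)) +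
      (∫ U : GaugeConfig 4 N (Matrix.specialUnitaryGroup (Fin 3) ℂ), (if (∃ n : ℕ, ∃ u : Fin n → ({p // wilsonBox (0 : TorusSite 4 N) s p} → ℂ), ∃ ev wgt : Fin n → ℝ, (∀ i j, ∑ p, star (u i p) * u j p = if i = j then 1 else 0) ∧ (∀ j, (wilsonCell U μv 0 s).mulVec (u j) = fun p => (ev j : ℂ) * gammaFive p.1.2.2 p.1.2.2 * u j p) ∧ (∀ j, |ev j| < 2 * τ ∧ 0 ≤ wgt j ∧ wgt j * |ev j| ≤ 1) ∧ (∀ j, ‖∑ p, star (u j p) * gammaFive p.1.2.2 p.1.2.2 * u j p‖ < χ₀) ∧ 1 / (4 * τ) < ∑ j, wgt j * ∑ p, if childrenInterior s p then (0 : ℝ) else ‖u j p‖ ^ 2) then (1 : ℝ) else 0) * ∏ f, ‖fermionDet (wilsonDirac (fundamentalRep (Fin 3)) U (mq f) 1)‖ ∂(wilsonMeasure (fundamentalRep (Fin 3)) β)) /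
        (∫ U : GaugeConfig 4 N (Matrix.specialUnitaryGroup (Fin 3) ℂ), ∏ f, ‖fermionDet (wilsonDirac (fundamentalRep (Fin 3)) U (mq f) 1)‖ ∂(wilsonMeasure (fundamentalRep (Fin 3)) β)) := by
  intro N _ β Nf mq s μv τ χ₀ E hE
  have hwt0 : ∀ U : GaugeConfig 4 N (Matrix.specialUnitaryGroup (Fin 3) ℂ),
      0 ≤ ∏ f, ‖fermionDet (wilsonDirac (fundamentalRep (Fin 3)) U (mq f) 1)‖ :=
    fun U => Finset.prod_nonneg fun f _ => norm_nonneg _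
  have hwtm : Measurable fun U : GaugeConfig 4 N (Matrix.specialUnitaryGroup (Fin 3) ℂ) =>
      ∏ f, ‖fermionDet (wilsonDirac (fundamentalRep (Fin 3)) U (mq f) 1)‖ := by
    simpa only [norm_det_diracMatrix] using measurable_norm_det_diracMatrix (S := N) mq
  have hwti : Integrable (fun U : GaugeConfig 4 N (Matrix.specialUnitaryGroup (Fin 3) ℂ) =>
      ∏ f, ‖fermionDet (wilsonDirac (fundamentalRep (Fin 3)) U (mq f) 1)‖)
      (wilsonMeasure (d := 4) (L := N) (fundamentalRep (Fin 3)) β) := by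
    simpa only [norm_det_diracMatrix] using integrable_norm_det_diracMatrix (S := N) mq
      (wilsonMeasure (d := 4) (L := N) (fundamentalRep (Fin 3)) β)
  exact CensusDominates.ratio_le _ _ hwt0 hwtm hwti E _ _
    (CensusDominates.measurableSet_chiral (N := N) s μv τ χ₀)
    (CensusDominates.measurableSet_achiral (N := N) s μv τ χ₀)
    (fun U hU => CensusDominates.pointwise s μv τ χ₀ U (hE U hU))

end Summit.QuantumFields.QCD.Cruxes.CoerciveSea.ChiralityCollapsesPseudospectrum

end
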